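import Literature.AlgebraicGeometry.Frobenioids.UnitTrivializationPerfectionModel
import Literature.AlgebraicGeometry.Frobenioids.ModelFrobenioidBaseChangeEquivalence
import Literature.AlgebraicGeometry.Frobenioids.ModelFrobenioidRootFunctors
import Literature.AlgebraicGeometry.Frobenioids.PerfectionModelTypeUnconditional
import Literature.AlgebraicGeometry.Frobenioids.UnitTrivializationModelType
import Literature.AlgebraicGeometry.Frobenioids.FrobenioidRealification
import HarnessLib

/-!
# Frobenioids I, Prop. 5.3: `(C^un-tr)^pf` IS "the model Frobenioid associated to `Φ^pf` and
# `ℚ · Φ^birat = (Φ^birat)^pf`" — the schema `PreFrobenioid.Prop53_untrPf` AT THE CONSTRUCTIONS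

Mochizuki, *The geometry of Frobenioids I: the general theory*, Kyushu J. Math. **62** (2008) 293–400, §5,
Proposition 5.3 p. 103 l. 16–19: "Moreover, the Frobenioid `C^un-tr` (respectively, `(C^un-tr)^pf`) is of model
type and may be obtained as the model Frobenioid associated to the divisor monoid `Φ` (respectively, `Φ^pf`) and
the rational function monoid `Φ^birat` (respectively, `ℚ · Φ^birat = Φ^birat ⊗_ℤ ℚ = (Φ^birat)^pf`)"
[cite: MochizukiFrdI2008, Prop. 5.3 p.103]; Proposition 5.5 (iv) p. 104 l. 43 ("the perfection of the model
Frobenioid associated to `Φ, B, Div_B` is the model Frobenioid associated to `Φ^pf, B^pf, B^pf → (Φ^gp)^pf`",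
with the identification `(Φ^gp)^pf = (Φ^pf)^gp`) [cite: MochizukiFrdI2008, Prop. 5.5 (iv) p.104].

PROOF-ONLY (seat abc-iut-L1-d5 gen 4; cell abc-iut, L1 sub-DAG `FrdI-Prop53-Cor54` row **P53/L04**, the
residual recorded in `UnitTrivializationPerfectionModel.lean`).  That file proves, over `D`,
`(C^un-tr)^pf ≌ model of (Φ^pf, (Φ^birat)^pf, Div^pf)` for ANY perfected divisor datum `Div^pf` on the abstract
perfection `(Φ^birat)^pf = perfectionFunctor (Φ^birat)` (abc-iut-L1-t5's `IsPerfectedDiv`).  Here the DATA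
IDENTIFICATION with abc-iut-L1-t5's rendering `ℚ · Φ^birat ⊆ (Φ^pf)^gp` (`GpSubfunctor.perfection`, the data of
`PreFrobenioid.untrPfModel F`) is made, and the schema `PreFrobenioid.Prop53_untrPf` is closed at THE
constructions:

* `GpSubfunctor.divBpf_mem_perfection` / `divBpf_injective` / `exists_divBpf_eq` — for a subfunctor of groups
  `Ψ ⊆ Φ^gp` (`Φ` integral objectwise) and perfected data `Div^pf : Ψ^pf → (Φ^pf)^gp`, `Div^pf` maps
  `Ψ(X)^pf` BIJECTIVELY onto `ℚ · Ψ(X) = {x ∈ (Φ^pf)^gp(X) | some xⁿ ∈ image of Ψ(X)}`: `Div^pf(c^{1/n})` is THE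
  `n`-th root of the image of `c` (roots are unique in `(Φ^pf)^gp`, `Perfection.gp_pow_injective`), and the
  kernel of `Φ^gp → (Φ^pf)^gp` is torsion (`exists_pow_eq_pow_of_gpApp_toPerfectionFunctor_eq`);
* `GpSubfunctor.exists_pfModel_equivalence` — hence the morphism of model data `(𝟙, Div^pf)` over `𝟭 D` from
  `(Φ^pf, Ψ^pf, Div^pf)` to `(Φ^pf, ℚ · Ψ, incl)` has bijective components, and abc-iut-w5-d137's
  `ModelFrobenioid.DataHomOver.functor_isEquivalence` makes the induced functor of model Frobenioids an
  equivalence, over `D` ON THE NOSE;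
* `PreFrobenioid.exists_untrPf_equiv_untrPfModel` — `(C^un-tr)^pf ≌ untrPfModel F` over `D`
  (`exists_untrPf_comparison_overBase` followed by the data identification);
* **`PreFrobenioid.prop53_untrPf_holds`** — the schema `Prop53_untrPf F IsOfModelType SU PU` at
  `SU :=` the operations of `C^un-tr → F_Φ` (`untrFunctor hF`), `PU :=` THE perfection datum
  `PreFrobenioidData.perfection (isFrobenioid_untr hF)` and `IsOfModelType S :=` "`S` is a Frobenioid of model
  type (Def. 4.5 (i), `PreFrobenioid.IsOfModelType`) at some square-completion datum"; the model-type half is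
  Prop. 5.5 (iii) for `C^un-tr` (abc-iut-w4-d108/abc-iut-L1-t3: `isOfModelType_untr'`, `isOfIsotropicType_untr`,
  `Perfection.isOfModelType_perfection'`).

Binders, BY NAME (no FACT-LIST row): `ModelFrobenioid.Hypotheses Φ (biratSubfunctor F).toMonoid` (Thm. 5.2's
standing hypotheses for `(Φ, Φ^birat)`, row P53/L02d) and a perfected divisor datum `DivBpf` with
`IsPerfectedDiv` (the currency of the slot `FrdI.Prop55Sub.Prop55iv_pf`).  No definitions; no statement of the
paper is re-typed; nothing here bears on [IUTchIII] Cor. 3.12.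
-/

namespace Literature.AlgebraicGeometry.Frobenioids

open CategoryTheory Opposite Function

universe w v u v' u'

/-! ### `Div^pf : Ψ^pf → (Φ^pf)^gp` is a bijection onto `ℚ · Ψ` -/

namespace GpSubfunctor

variable {D : Type u} [Category.{v} D] {Φ : Dᵒᵖ ⥤ CommMonCat.{w}} (Ψ : GpSubfunctor Φ)
  {DivBpf : perfectionFunctor Ψ.toMonoid ⟶ monoidGp (perfectionFunctor Φ)}

/-- `Div^pf(c^{1/n})ⁿ = ι^gp(c)` for `c ∈ Ψ(A)`: the compatibility `IsPerfectedDiv` on the class `c^{1/n}`.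
[cite: MochizukiFrdI2008, Prop. 5.5 (iv) p.104] -/
theorem divBpf_mk_pow (hDiv : IsPerfectedDiv Φ Ψ.toMonoid Ψ.incl DivBpf) (A : Dᵒᵖ)
    (c : Ψ.toMonoid.obj A) (n : ℕ+) :
    divB (perfectionFunctor Φ) (perfectionFunctor Ψ.toMonoid) DivBpf A (Perfection.mk c n) ^ (n : ℕ) =
      gpApp (toPerfectionFunctor Φ) A (divB Φ Ψ.toMonoid Ψ.incl A c) := by
  have e : (Perfection.mk c n : (perfectionFunctor Ψ.toMonoid).obj A) ^ (n : ℕ) =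
      ((toPerfectionFunctor Ψ.toMonoid).app A).hom c :=
    Perfection.mk_pow_self c n
  rw [← map_pow]
  exact (congrArg (divB (perfectionFunctor Φ) (perfectionFunctor Ψ.toMonoid) DivBpf A) e).trans
    (ModelFrobenioid.divB_toPerfectionFunctor hDiv A c)

/-- `Div_Ψ = incl : Ψ(A) ↪ Φ^gp(A)` takes values in `Ψ(A)` (tautology of abc-iut-L1-t5's `GpSubfunctor.incl`).
[cite: MochizukiFrdI2008, Prop. 5.3 p.103] -/
theorem divB_incl_mem (A : Dᵒᵖ) (c : Ψ.toMonoid.obj A) : divB Φ Ψ.toMonoid Ψ.incl A c ∈ Ψ.carrier (unop A) :=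
  (c : Ψ.carrier (unop A)).2

/-- `Div_Ψ = incl : Ψ(A) ↪ Φ^gp(A)` is injective. [cite: MochizukiFrdI2008, Prop. 5.3 p.103] -/
theorem divB_incl_injective (A : Dᵒᵖ) : Injective (divB Φ Ψ.toMonoid Ψ.incl A) :=
  fun c₁ c₂ e => Subtype.ext (a1 := (c₁ : Ψ.carrier (unop A))) (a2 := (c₂ : Ψ.carrier (unop A))) e

/-- `Div^pf` takes values in `ℚ · Ψ ⊆ (Φ^pf)^gp` (abc-iut-L1-t5's `GpSubfunctor.perfection`).
[cite: MochizukiFrdI2008, Prop. 5.3 p.103] -/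
theorem divBpf_mem_perfection (hDiv : IsPerfectedDiv Φ Ψ.toMonoid Ψ.incl DivBpf) (A : Dᵒᵖ)
    (v : (perfectionFunctor Ψ.toMonoid).obj A) :
    divB (perfectionFunctor Φ) (perfectionFunctor Ψ.toMonoid) DivBpf A v ∈
      Ψ.perfection.carrier (unop A) := by
  obtain ⟨⟨c, n⟩, rfl⟩ := Perfection.mk_surjective v
  exact ⟨n, Subgroup.mem_map.mpr ⟨divB Φ Ψ.toMonoid Ψ.incl A c, Ψ.divB_incl_mem A c,
    (Ψ.divBpf_mk_pow hDiv A c n).symm⟩⟩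

/-- `Div^pf` is injective on `Ψ(A)^pf` (`Φ(A)` integral): equal images have equal `n₁n₂`-th powers
`ι^gp(c₁^{n₂}) = ι^gp(c₂^{n₁})`, the kernel of `ι^gp` is torsion, and torsion-related pairs define the same class
of `Ψ(A)^pf`. [cite: MochizukiFrdI2008, Prop. 5.5 (iv) p.104] -/
theorem divBpf_injective (hΦc : ∀ A : Dᵒᵖ, IsCancelMul (Φ.obj A))
    (hDiv : IsPerfectedDiv Φ Ψ.toMonoid Ψ.incl DivBpf) (A : Dᵒᵖ) :
    Injective (divB (perfectionFunctor Φ) (perfectionFunctor Ψ.toMonoid) DivBpf A) := by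
  haveI := hΦc A
  intro v₁ v₂ h
  obtain ⟨⟨c₁, n₁⟩, rfl⟩ := Perfection.mk_surjective v₁
  obtain ⟨⟨c₂, n₂⟩, rfl⟩ := Perfection.mk_surjective v₂
  have h1 : gpApp (toPerfectionFunctor Φ) A (divB Φ Ψ.toMonoid Ψ.incl A (c₁ ^ (n₂ : ℕ))) =
      gpApp (toPerfectionFunctor Φ) A (divB Φ Ψ.toMonoid Ψ.incl A (c₂ ^ (n₁ : ℕ))) := by
    rw [map_pow, map_pow, map_pow, map_pow, ← Ψ.divBpf_mk_pow hDiv A c₁ n₁, ← Ψ.divBpf_mk_pow hDiv A c₂ n₂,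
      ← pow_mul, ← pow_mul, h, mul_comm]
  obtain ⟨s, hs⟩ := exists_pow_eq_pow_of_gpApp_toPerfectionFunctor_eq A h1
  refine Perfection.mk_eq_mk_iff.mpr ⟨s, Ψ.divB_incl_injective A ?_⟩
  rw [mul_comm (s : ℕ), mul_comm (s : ℕ), pow_mul, pow_mul, map_pow, map_pow (divB Φ Ψ.toMonoid Ψ.incl A)]
  exact hs

/-- `Div^pf` maps `Ψ(A)^pf` ONTO `ℚ · Ψ(A)`: if `xⁿ = ι^gp(b)` with `b ∈ Ψ(A)`, then `x = Div^pf(b^{1/n})`, both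
being THE `n`-th root (`Φ(A)` integral). [cite: MochizukiFrdI2008, Prop. 5.3 p.103] -/
theorem exists_divBpf_eq (hΦc : ∀ A : Dᵒᵖ, IsCancelMul (Φ.obj A))
    (hDiv : IsPerfectedDiv Φ Ψ.toMonoid Ψ.incl DivBpf) (A : Dᵒᵖ)
    {x : Algebra.GrothendieckGroup ((perfectionFunctor Φ).obj A)} (hx : x ∈ Ψ.perfection.carrier (unop A)) :
    ∃ v : (perfectionFunctor Ψ.toMonoid).obj A,
      divB (perfectionFunctor Φ) (perfectionFunctor Ψ.toMonoid) DivBpf A v = x := by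
  haveI := hΦc A
  obtain ⟨n, b, hb, hbx⟩ := hx
  let c : Ψ.toMonoid.obj A := (⟨b, hb⟩ : Ψ.carrier (unop A))
  refine ⟨Perfection.mk c n, ?_⟩
  have key : divB (perfectionFunctor Φ) (perfectionFunctor Ψ.toMonoid) DivBpf A (Perfection.mk c n) ^ (n : ℕ) =
      x ^ (n : ℕ) := by
    rw [Ψ.divBpf_mk_pow hDiv A c n]
    exact hbx
  exact Perfection.gp_pow_injective n key

/-- **`model of (Φ^pf, Ψ^pf, Div^pf) ≌ model of (Φ^pf, ℚ · Ψ, incl)`, over `D` on the nose** — the morphism of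
model data `(𝟙_{Φ^pf}, Div^pf)` over `𝟭 D` has bijective components, so the induced functor (abc-iut-w5-d048's
`DataHomOver.functor`) is an equivalence (abc-iut-w5-d137's `DataHomOver.functor_isEquivalence`): the
identification "`B^pf → (Φ^gp)^pf = (Φ^pf)^gp`" of Prop. 5.5 (iv) with "`ℚ · Φ^birat = (Φ^birat)^pf`" of Prop. 5.3
at the level of model Frobenioids. [cite: MochizukiFrdI2008, Prop. 5.3 p.103] -/
theorem exists_pfModel_equivalence (hΦc : ∀ A : Dᵒᵖ, IsCancelMul (Φ.obj A))
    (hDiv : IsPerfectedDiv Φ Ψ.toMonoid Ψ.incl DivBpf) :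
    ∃ T : ModelFrobenioid (perfectionFunctor Φ) (perfectionFunctor Ψ.toMonoid) DivBpf ≌ Ψ.PfModelOf,
      T.functor ⋙ ModelFrobenioid.baseFunctor _ _ _ = ModelFrobenioid.baseFunctor _ _ _ := by
  let β : perfectionFunctor Ψ.toMonoid ⟶ (𝟭 D).op ⋙ Ψ.perfection.toMonoid :=
    { app := fun A => CommMonCat.ofHom
        ((divB (perfectionFunctor Φ) (perfectionFunctor Ψ.toMonoid) DivBpf A).codRestrict
          (Ψ.perfection.carrier (unop A)) (Ψ.divBpf_mem_perfection hDiv A))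
      naturality := fun A A' f => by
        apply CommMonCat.hom_ext
        ext v
        apply Subtype.ext
        exact (pullGp_divB (Φ := perfectionFunctor Φ) (B := perfectionFunctor Ψ.toMonoid)
          (DivB := DivBpf) f.unop v).symm }
  let h : ModelFrobenioid.DataHomOver (𝟭 D) DivBpf Ψ.perfection.incl :=
    { η := 𝟙 (perfectionFunctor Φ)
      β := β
      comm := fun A u => by
        change MonGp.map ((𝟙 (perfectionFunctor Φ) : perfectionFunctor Φ ⟶ perfectionFunctor Φ).app A).hom
            (divB (perfectionFunctor Φ) (perfectionFunctor Ψ.toMonoid) DivBpf A u) =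
          divB (perfectionFunctor Φ) (perfectionFunctor Ψ.toMonoid) DivBpf A u
        rw [NatTrans.id_app, CommMonCat.hom_id, MonGp.map_id]
        rfl }
  have hη : ∀ X : D, Bijective (h.η.app (op X)).hom := fun X => by
    change Bijective ((𝟙 (perfectionFunctor Φ) : perfectionFunctor Φ ⟶ perfectionFunctor Φ).app (op X)).hom
    rw [NatTrans.id_app, CommMonCat.hom_id]
    exact bijective_id
  have hβ : ∀ X : D, Bijective (h.β.app (op X)).hom := fun X =>
    ⟨fun v₁ v₂ e => Ψ.divBpf_injective hΦc hDiv (op X) (congrArg Subtype.val e), fun y => by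
      obtain ⟨v, hv⟩ := Ψ.exists_divBpf_eq hΦc hDiv (op X) y.2
      exact ⟨v, Subtype.ext hv⟩⟩
  haveI := h.functor_isEquivalence hη hβ
  exact ⟨h.functor.asEquivalence, h.functor_comp_baseFunctor.trans (Functor.comp_id _)⟩

end GpSubfunctor

/-! ### Prop. 5.3 for `(C^un-tr)^pf` at THE constructions -/

namespace PreFrobenioid

variable {D : Type u} [Category.{v} D] {Φ : Dᵒᵖ ⥤ CommMonCat.{w}}
  {C : Type u'} [Category.{v'} C] {F : C ⥤ ElemFrobenioid Φ}

/-- **`(C^un-tr)^pf ≌` "the model Frobenioid associated to `Φ^pf` and `ℚ · Φ^birat = (Φ^birat)^pf`"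
(`untrPfModel F`), over `D`** (Prop. 5.3 p. 103 l. 16–19): `exists_untrPf_comparison_overBase` followed by the
data identification `GpSubfunctor.exists_pfModel_equivalence` (`Φ` is integral objectwise since `C` is a
Frobenioid). [cite: MochizukiFrdI2008, Prop. 5.3 p.103] -/
theorem exists_untrPf_equiv_untrPfModel (hF : IsFrobenioid F)
    (h : ModelFrobenioid.Hypotheses Φ (biratSubfunctor F).toMonoid)
    (DivBpf : perfectionFunctor (biratSubfunctor F).toMonoid ⟶ monoidGp (perfectionFunctor Φ))
    (hDiv : IsPerfectedDiv Φ (biratSubfunctor F).toMonoid (biratSubfunctor F).incl DivBpf) :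
    ∃ e : Perfection (isFrobenioid_untr hF) ≌ untrPfModel F,
      Nonempty (e.functor ⋙ ModelFrobenioid.baseFunctor _ _ _ ≅ (Perfection.ops (isFrobenioid_untr hF)).base) := by
  have hΦc : ∀ A : Dᵒᵖ, IsCancelMul (Φ.obj A) := fun A =>
    isIntegral_iff_isCancelMul.mp (hF.isPreFrobenioid.isDivisorial (unop A)).isPreDivisorial.isIntegral
  obtain ⟨e₀, ⟨i₀⟩⟩ := exists_untrPf_comparison_overBase hF h DivBpf hDiv
  obtain ⟨T, hT⟩ := (biratSubfunctor F).exists_pfModel_equivalence hΦc hDiv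
  exact ⟨e₀.trans T, ⟨Functor.associator _ _ _ ≪≫ Functor.isoWhiskerLeft e₀.functor (eqToIso hT) ≪≫ i₀⟩⟩

/-- **Proposition 5.3, "Moreover", second half — the schema `PreFrobenioid.Prop53_untrPf` AT THE CONSTRUCTIONS**:
for the unit-trivialisation `C^un-tr → F_Φ` (`untrFunctor hF`) and THE perfection datum of `C^un-tr`
(`PreFrobenioidData.perfection (isFrobenioid_untr hF)`, Def. 3.1 (iii)), `(C^un-tr)^pf` is a Frobenioid of model
type (Def. 4.5 (i), `PreFrobenioid.IsOfModelType`, at some square-completion datum — Prop. 5.5 (iii)) AND there is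
an equivalence `(C^un-tr)^pf ⥲ untrPfModel F` lying over `D`.  Binders: Thm. 5.2's standing hypotheses for
`(Φ, Φ^birat)` and a perfected divisor datum (`IsPerfectedDiv`). [cite: MochizukiFrdI2008, Prop. 5.3 p.103] -/
theorem prop53_untrPf_holds (hF : IsFrobenioid F)
    (h : ModelFrobenioid.Hypotheses Φ (biratSubfunctor F).toMonoid)
    (DivBpf : perfectionFunctor (biratSubfunctor F).toMonoid ⟶ monoidGp (perfectionFunctor Φ))
    (hDiv : IsPerfectedDiv Φ (biratSubfunctor F).toMonoid (biratSubfunctor F).incl DivBpf) :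
    Prop53_untrPf F
      (fun S => ∃ (hS : IsFrobenioid S.toFunctor) (hsq : HasBiratSquares S.toFunctor),
        IsOfModelType S.toFunctor hS hsq)
      (PreFrobenioidData.ofFunctor Φ (untrFunctor hF))
      (PreFrobenioidData.perfection (isFrobenioid_untr hF)) := fun _ =>
  ⟨⟨Perfection.isFrobenioid (isFrobenioid_untr hF)
      (Perfection.isOfType_isFrobeniusIsotropic_of_isOfIsotropicType (isFrobenioid_untr hF)
        (isOfIsotropicType_untr hF)), _,
    Perfection.isOfModelType_perfection' (isFrobenioid_untr hF) (isOfIsotropicType_untr hF)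
      (isOfModelType_untr' hF)⟩,
   exists_untrPf_equiv_untrPfModel hF h DivBpf hDiv⟩

end PreFrobenioid

end Literature.AlgebraicGeometry.Frobenioids
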